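import Summits.CriticalPhenomena.PercolationContinuityZ3.Theorems.Transplant.Slab111VGeo
import Summits.CriticalPhenomena.PercolationContinuityZ3.Theorems.Transplant.Slab111VRide
import HarnessLib

/-!
# The routing certificate for `ShapedLinkage 3 (Slab111.hexShadow k)`, I: PLANS and their CHECKER (computable data, Boolean tests)

builds on p205010 (kernel theorem, internal audit signed; external expert review pending) — NOT used in this file.  Lane `prim-bschramm`, seat
`prim-bschramm-p2` (gen 35; class C1b; memo `HOME/bschramm/P2-LATTICES.md` §129); helper file (`--supports stmt-CriticalPhenomena-4575 --as helper`).

A PLAN describes a swap pair of routings of «HexShadowVRouteData» for one block (reduced type `BKey`, centre class `c0`, `k mod 3 = kr`) and one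
column configuration `(c₁, c₂, c₃)` of the terminals `E₁, E₂, w'`, uniformly in the terminal LEVELS: a rhombus DIAMOND `cA ∼ y ∼ cB`, `cA ∼ b ∼ cB`
(«VDiamond»), rigid cores `A : p₁ ⇝ cA`, `B : cB ⇝ p₂`, `T1 : b ⇝ p₃`, `T2 : y ⇝ p₃'` (relative model vertices `((a,b),λ)`, «Slab111VGeo»), and for each
terminal either an EXACT rigid position or a RIDE («Slab111VRide») along a face `F` from the port to the terminal's level (plus one extra step when the
terminal column is adjacent to, not on, the face: `ext = ±1`), confined to a REGION = footprint columns × envelope of relative levels.  The KIND fixes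
how the reference level `ℓ` is chosen (`free`: anywhere; `bot ℓ₀`: `ℓ = ℓ₀`; `top m`: `ℓ = k − m`; `stk λ₀`: `ℓ = h_low − λ₀` for `E₁, E₂` on one column).
* §1 data: `BKey`, `AttD`, `Env`, `TermD`, `Kind`, `PlanD`; column tests (`colW`, `colRW`), `AttD.ok`, regions (`TermD.blocks`, `TermD.isPort`);
* §2 **`PlanD.check C : Bool`** — structure (chains, rhombus, ports), validity of rigid vertices, self-avoidance, region avoidance, footprint
  disjointness, kind-specific level bookkeeping and boundary peel codes (`contactOK`);
* §3 statuses of terminal levels (`0,1,2`, middle `9`, `10,11,12 = k−2,k−1,k`), `rideStatusOK`, **`PlanD.allows`** (which status triples a plan serves).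
Soundness (a checked plan yields a swap pair of `VRouteData`) is «Slab111VSoundA–C», «Slab111VLevels»; the plans themselves are found by the kernel («Slab111VSearch»).
[cite: DuminilCopinSidoraviciusTassion2016, §2.3 (proof of Fact 2: the three disjoint paths γ_u, γ_v, γ_w in B_R(z))]
-/

namespace Summit.CriticalPhenomena.PercolationContinuityZ3.Theorems.Transplant

namespace Slab111

/-! ## §1 Data -/

/-- A relative column. [folklore] -/
abbrev Col := ℤ × ℤ

/-- The relative class datum `a + 2b` of a column. [folklore] -/
def lvlC (q : Col) : ℤ := q.1 + 2 * q.2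

/-- Reduced block type: clip parameters capped at `3`, `tD ≤ tR + 1`, `sD ≤ sR + 1`. [folklore] -/
structure BKey where
  /-- `t`-clip of the rerouting block -/
  tR : ℕ
  /-- `t`-clip of the cleared block -/
  tD : ℕ
  /-- `s`-clip of the rerouting block -/
  sR : ℕ
  /-- `s`-clip of the cleared block -/
  sD : ℕ
deriving DecidableEq, Repr

/-- Checking context: reduced block type, centre class `c0`, `k mod 3`, and the block's peel table (`Ctx.of` fills it from «Slab111VShapes»). [folklore] -/
structure Ctx where
  /-- block type -/
  K : BKey
  /-- centre class -/
  c0 : ℕ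
  /-- `k mod 3` -/
  kr : ℕ
  /-- peel table of the block: (relative column, level code) -/
  tab : List ((ℤ × ℤ) × ℕ)
deriving Repr

/-- The context of a block type and residue pair, with the peel table of «Slab111VShapes». [folklore] -/
noncomputable def Ctx.of (K : BKey) (c0 kr : ℕ) : Ctx := ⟨K, c0, kr, peelTab K.tR K.tD K.sR K.sD c0 kr⟩

/-- The column carries the level code in the context's peel table. [folklore] -/
def Ctx.hasCode (C : Ctx) (q : Col) (code : ℕ) : Bool := C.tab.any fun e => e.1 == q && e.2 == code

/-- Column carries no fully-peeled code (`4`). [folklore] -/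
def noCode4 (C : Ctx) (q : Col) : Bool := !C.hasCode q 4

/-- Column usable by the branch at middle levels: in the cleared block and not fully peeled. [folklore] -/
def colW (C : Ctx) (q : Col) : Bool := inBlkB C.K.tD C.K.sD q && noCode4 C q

/-- Column usable by the rerouted piece: additionally in the rerouting block. [folklore] -/
def colRW (C : Ctx) (q : Col) : Bool := inBlkB C.K.tR C.K.sR q && colW C q

/-- Relative validity of a model vertex (Boolean). [folklore] -/
def vOK (p : MV) : Bool := decide (RAdm p)

/-- `MStep` as a Boolean. [folklore] -/
def mstepB (p q : MV) : Bool := decide (MStep p q)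

/-- `IsUp` as a Boolean. [folklore] -/
def isUpB (p q : Col) : Bool := decide (IsUp p q)

/-- Consecutive model steps along a list. [folklore] -/
def chainB : List MV → Bool
  | [] => true
  | [_] => true
  | a :: b :: l => mstepB a b && chainB (b :: l)

/-- A ride attachment: face `F`, terminal column `c`, extra step `ext ∈ {0, 1, −1}` (`0`: `c` on the face). [folklore] -/
structure AttD where
  /-- the face -/
  F : FaceD
  /-- the terminal column -/
  c : Col
  /-- the extra step -/
  ext : ℤ
deriving DecidableEq, Repr

/-- The three face columns. [folklore] -/
def AttD.fcols (a : AttD) : List Col := [a.F.f0, a.F.f1, a.F.f2]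

/-- The footprint columns: the terminal column and the face. [folklore] -/
def AttD.foot (a : AttD) : List Col := a.c :: a.fcols

/-- The face column reached at the target level (class `lvlC c + ext`). [folklore] -/
def AttD.tcol (a : AttD) : Col := colAt a.F (lvlC a.c + a.ext)

/-- Well-formed attachment for a terminal of the rerouted piece (`roleE = true`) or of the branch. [folklore] -/
def AttD.ok (C : Ctx) (roleE : Bool) (a : AttD) : Bool :=
  decide a.F.ok && a.fcols.all (fun q => if roleE then colRW C q else colW C q) &&
  (if roleE then colRW C a.c else colW C a.c) &&
  ((a.ext == 0 && a.fcols.contains a.c) || (a.ext == -1 && !a.fcols.contains a.c && isUpB a.tcol a.c) ||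
    (a.ext == 1 && !a.fcols.contains a.c && isUpB a.c a.tcol))

/-- Envelope of relative levels of a ride region. [folklore] -/
inductive Env where
  /-- all levels -/
  | any : Env
  /-- levels `≥ fl` -/
  | ge : ℤ → Env
  /-- levels `≤ ce` -/
  | le : ℤ → Env
deriving DecidableEq, Repr

/-- Membership of a relative level in an envelope. [folklore] -/
def Env.mem : Env → ℤ → Bool
  | Env.any, _ => true
  | Env.ge fl, lam => decide (fl ≤ lam)
  | Env.le ce, lam => decide (lam ≤ ce)

/-- A terminal option: an exact rigid position, or a ride in a region. [folklore] -/
inductive TermD where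
  /-- the terminal IS this relative vertex -/
  | exact : MV → TermD
  /-- the terminal is reached by a ride -/
  | ride : AttD → Env → TermD
deriving DecidableEq, Repr

/-- The model vertex `w` lies in the ride region of the terminal option. [folklore] -/
def TermD.blocks : TermD → MV → Bool
  | TermD.exact _, _ => false
  | TermD.ride a e, w => a.foot.contains w.1 && e.mem w.2

/-- The model vertex `w` is an admissible port of the terminal option (for `exact`: the terminal itself). [folklore] -/
def TermD.isPort : TermD → MV → Bool
  | TermD.exact v, w => w == v
  | TermD.ride a e, w => a.fcols.contains w.1 && e.mem w.2

/-- The two options are rides with overlapping footprints. [folklore] -/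
def TermD.clash : TermD → TermD → Bool
  | TermD.ride a _, TermD.ride a' _ => a.foot.any fun q => a'.foot.contains q
  | _, _ => false

/-- Well-formedness of a terminal option. [folklore] -/
def TermD.ok (C : Ctx) (roleE : Bool) : TermD → Bool
  | TermD.exact v => vOK v && (if roleE then colRW C v.1 else colW C v.1)
  | TermD.ride a _ => a.ok C roleE

/-- How the reference level is chosen. [folklore] -/
inductive Kind where
  /-- anywhere (all rigid levels middle, up to the contact checks) -/
  | free : Kind
  /-- `ℓ = ℓ₀` (small, fixed) -/
  | bot : ℤ → Kind
  /-- `ℓ = k − m` -/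
  | top : ℤ → Kind
  /-- `E₁, E₂` on one column: `ℓ = h_low − λ₀`; `low = true` iff `E₁` is the lower one -/
  | stk : ℤ → Bool → Kind
deriving DecidableEq, Repr

/-- **A plan.** [folklore] -/
structure PlanD where
  /-- kind -/
  kind : Kind
  /-- terminal options of `E₁`, `E₂`, and of `w'` for the two branches -/
  t1 : TermD
  /-- see `t1` -/
  t2 : TermD
  /-- see `t1` -/
  t3a : TermD
  /-- see `t1` -/
  t3b : TermD
  /-- diamond apex where `A` ends -/
  cA : MV
  /-- diamond apex where `B` starts -/
  cB : MV
  /-- middle vertex on the first rerouting -/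
  y : MV
  /-- middle vertex heading the first branch -/
  b : MV
  /-- rigid core `p₁ … cA` -/
  A : List MV
  /-- rigid core `cB … p₂` -/
  B : List MV
  /-- rigid branch core `b … p₃` -/
  T1 : List MV
  /-- rigid branch core `y … p₃'` -/
  T2 : List MV
deriving DecidableEq, Repr

/-! ## §2 The checker -/

/-- All rigid vertices of a plan. [folklore] -/
def PlanD.rigid (P : PlanD) : List MV := P.A ++ P.y :: P.b :: P.B ++ P.T1 ++ P.T2

/-- Minimum relative level of the rigid vertices. [folklore] -/
def PlanD.lamMin (P : PlanD) : ℤ := (P.rigid.map Prod.snd).foldl min P.cA.2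
/-- Maximum relative level of the rigid vertices. [folklore] -/
def PlanD.lamMax (P : PlanD) : ℤ := (P.rigid.map Prod.snd).foldl max P.cA.2

/-- Structure: chains, rhombus adjacencies, heads and ends. [folklore] -/
def PlanD.structOK (P : PlanD) : Bool :=
  chainB P.A && chainB P.B && chainB P.T1 && chainB P.T2 &&
  (P.A.getLast? == some P.cA) && (P.B.head? == some P.cB) && (P.T1.head? == some P.b) && (P.T2.head? == some P.y) &&
  mstepB P.cA P.y && mstepB P.y P.cB && mstepB P.cA P.b && mstepB P.b P.cB

/-- Validity and columns of the rigid vertices: rerouted piece over usable rerouting columns, branches over usable columns. [folklore] -/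
def PlanD.validOK (C : Ctx) (P : PlanD) : Bool :=
  (P.A ++ P.y :: P.b :: P.B).all (fun w => vOK w && colRW C w.1) && (P.T1 ++ P.T2).all (fun w => vOK w && colW C w.1)

/-- Self-avoidance and disjointness of the rigid pieces. [folklore] -/
def PlanD.nodupOK (P : PlanD) : Bool :=
  decide P.A.Nodup && decide P.B.Nodup && decide P.T1.Nodup && decide P.T2.Nodup &&
  !P.A.contains P.y && !P.B.contains P.y && !P.A.contains P.b && !P.B.contains P.b && !(P.y == P.b) &&
  P.B.all (fun w => !P.A.contains w) &&
  P.T1.all (fun w => !P.A.contains w && !(w == P.y) && !P.B.contains w) &&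
  P.T2.all (fun w => !P.A.contains w && !(w == P.b) && !P.B.contains w)

/-- Ports: the first vertex of `A`, the last of `B`, `T1`, `T2` are admissible ports of the respective terminal options. [folklore] -/
def PlanD.portOK (P : PlanD) : Bool :=
  (match P.A.head? with | some p => P.t1.isPort p | none => false) &&
  (match P.B.getLast? with | some p => P.t2.isPort p | none => false) &&
  (match P.T1.getLast? with | some p => P.t3a.isPort p | none => false) &&
  (match P.T2.getLast? with | some p => P.t3b.isPort p | none => false)

/-- Region avoidance: no rigid vertex other than the own port lies in a terminal's ride region; ride footprints pairwise disjoint. [folklore] -/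
def PlanD.regionOK (P : PlanD) : Bool :=
  (P.A.tail ++ P.y :: P.b :: P.B ++ P.T1 ++ P.T2).all (fun w => !P.t1.blocks w) &&
  (P.A ++ P.y :: P.b :: P.B.dropLast ++ P.T1 ++ P.T2).all (fun w => !P.t2.blocks w) &&
  (P.A ++ P.y :: P.B ++ P.T1.dropLast).all (fun w => !P.t3a.blocks w) &&
  (P.A ++ P.b :: P.B ++ P.T2.dropLast).all (fun w => !P.t3b.blocks w) &&
  !P.t1.clash P.t2 && !P.t1.clash P.t3a && !P.t2.clash P.t3a && !P.t1.clash P.t3b && !P.t2.clash P.t3b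

/-- Terminal options well-formed (`E`-role for `t1, t2`). [folklore] -/
def PlanD.termsOK (C : Ctx) (P : PlanD) : Bool :=
  P.t1.ok C true && P.t2.ok C true && P.t3a.ok C false && P.t3b.ok C false

/-- Code test at an absolute boundary level: `lvcode = 0,1` (levels `0,1`: codes `0,1` banned) or `2,3` (levels `k−1,k`: codes `2,3` banned). [folklore] -/
def codeFree (C : Ctx) (code : ℕ) (q : Col) : Bool := !C.hasCode q code

/-- The face column of a ride at absolute bottom level `L ∈ {0,1}` / top offset `j ∈ {0,1}` (level `k − j`). [folklore] -/
def AttD.colBot (a : AttD) (c0 : ℕ) (L : ℤ) : Col := colAt a.F (L - c0)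
/-- See `colBot`. [folklore] -/
def AttD.colTop (a : AttD) (c0 kr : ℕ) (j : ℤ) : Col := colAt a.F ((kr : ℤ) - j - c0)

/-- The ride ports of a plan with their options (those of `t1 … t3b` that are rides). [folklore] -/
def PlanD.ridePorts (P : PlanD) : List (TermD × MV) :=
  (match P.t1, P.A.head? with | t@(TermD.ride _ _), some p => [(t, p)] | _, _ => []) ++
  (match P.t2, P.B.getLast? with | t@(TermD.ride _ _), some p => [(t, p)] | _, _ => []) ++
  (match P.t3a, P.T1.getLast? with | t@(TermD.ride _ _), some p => [(t, p)] | _, _ => []) ++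
  (match P.t3b, P.T2.getLast? with | t@(TermD.ride _ _), some p => [(t, p)] | _, _ => [])

/-- Boolean implication. [folklore] -/
def bimp (c x : Bool) : Bool := !c || x

/-- Port clause of the bottom contact check: a ride port at level `0` has a code-`1`-free face column at level `1`. [folklore] -/
def portBotOK (C : Ctx) (ell : ℤ) : TermD × MV → Bool
  | (TermD.ride a _, p) => bimp (ell + p.2 == 0) (codeFree C 1 (a.colBot C.c0 1))
  | _ => true

/-- Port clause of the top contact check: a ride port at level `k` has a code-`2`-free face column at level `k − 1`. [folklore] -/
def portTopOK (C : Ctx) (j0 : ℤ) : TermD × MV → Bool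
  | (TermD.ride a _, p) => bimp (j0 - p.2 == 0) (codeFree C 2 (a.colTop C.c0 C.kr 1))
  | _ => true

/-- **Bottom contact check** for a placement with `ℓ + λmin = d` (`d ∈ {0,1}`): every rigid vertex at absolute level `0` / `1` is code-`0` / code-`1`
free, and a ride port at level `0` has a code-`1`-free face column at level `1`. [folklore] -/
def PlanD.contactBotOK (C : Ctx) (P : PlanD) (d : ℤ) : Bool :=
  let ell := d - P.lamMin
  P.rigid.all (fun w => bimp (ell + w.2 == 0) (codeFree C 0 w.1) && bimp (ell + w.2 == 1) (codeFree C 1 w.1)) && P.ridePorts.all (portBotOK C ell)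

/-- **Top contact check** for a placement with `ℓ + λmax = k − d` (`d ∈ {0,1}`): the relative level `λ` sits at absolute level `k − j` with
`j = d + λmax − λ`. [folklore] -/
def PlanD.contactTopOK (C : Ctx) (P : PlanD) (d : ℤ) : Bool :=
  let j0 := d + P.lamMax
  P.rigid.all (fun w => bimp (j0 - w.2 == 0) (codeFree C 3 w.1) && bimp (j0 - w.2 == 1) (codeFree C 2 w.1)) && P.ridePorts.all (portTopOK C j0)

/-- The option is a ride with envelope `any`. [folklore] -/
def TermD.isRideAny : TermD → Bool
  | TermD.ride _ Env.any => true
  | _ => false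

/-- Smallest level `≥ 3` over the column `c` (centre class `c0`): the lowest level of a FAR terminal on `c` in a bottom-anchored plan. [folklore] -/
def botFloor (c0 : ℕ) (c : Col) : ℤ := 3 + (((c0 : ℤ) + lvlC c - 3) % 3)
/-- Offset `j ≥ 3` such that `k − j` is the largest level `≤ k − 3` over the column `c`. [folklore] -/
def topOff (c0 kr : ℕ) (c : Col) : ℤ := 3 + (((kr : ℤ) - 3 - c0 - lvlC c) % 3)

/-- Envelope admissibility in a bottom-anchored plan: a far ride's region starts no higher than the lowest far level of its column (one lower for a
downward extra step); no `le` envelopes. [folklore] -/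
def TermD.botEnvOK (c0 : ℕ) (ell : ℤ) : TermD → Bool
  | TermD.ride a (Env.ge fl) => decide (fl ≤ botFloor c0 a.c - ell + min a.ext 0)
  | TermD.ride _ (Env.le _) => false
  | _ => true

/-- Envelope admissibility in a top-anchored plan (`ℓ = k − m`). [folklore] -/
def TermD.topEnvOK (c0 kr : ℕ) (m : ℤ) : TermD → Bool
  | TermD.ride a (Env.le ce) => decide (m - topOff c0 kr a.c + max a.ext 0 ≤ ce)
  | TermD.ride _ (Env.ge _) => false
  | _ => true

/-- The shape of a stack plan's `E`-options: the low one exact at `(c, λ₀)`, the high one riding its column's attachment from `λ₀ + 3` up. [folklore] -/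
def stkPairOK (lam0 : ℤ) : TermD → TermD → Bool
  | TermD.exact v, TermD.ride a (Env.ge fl) => (v == ((a.c.1, a.c.2), lam0)) && decide (fl ≤ lam0 + 3 + min a.ext 0)
  | _, _ => false

/-- Envelope admissibility of the terminal options for the kind. [folklore] -/
def PlanD.envOK (C : Ctx) (P : PlanD) : Bool :=
  match P.kind with
  | Kind.free => [P.t1, P.t2, P.t3a, P.t3b].all TermD.isRideAny
  | Kind.bot ell => [P.t1, P.t2, P.t3a, P.t3b].all (TermD.botEnvOK C.c0 ell)
  | Kind.top m => [P.t1, P.t2, P.t3a, P.t3b].all (TermD.topEnvOK C.c0 C.kr m)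
  | Kind.stk lam0 low => stkPairOK lam0 (if low then P.t1 else P.t2) (if low then P.t2 else P.t1) && [P.t3a, P.t3b].all TermD.isRideAny

/-- Kind-specific level bookkeeping: the boundary contact / range conditions. `kmin` of a plan is computed separately (`PlanD.kmin`). [folklore] -/
def PlanD.levelsOK (C : Ctx) (P : PlanD) : Bool :=
  match P.kind with
  | Kind.free =>
      -- the level lemma places ℓ ≡ c0 with 0 ≤ ℓ + λmin and ℓ + λmax ≤ k; contacts with the bottom at offsets 0,1 and the top at 0,1 must be clean
      bimp ((0 - P.lamMin) % 3 == (C.c0 : ℤ) % 3) (P.contactBotOK C 0) && bimp ((1 - P.lamMin) % 3 == (C.c0 : ℤ) % 3) (P.contactBotOK C 1) &&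
      bimp (((C.kr : ℤ) - 0 - P.lamMax) % 3 == (C.c0 : ℤ) % 3) (P.contactTopOK C 0) && bimp (((C.kr : ℤ) - 1 - P.lamMax) % 3 == (C.c0 : ℤ) % 3) (P.contactTopOK C 1)
  | Kind.bot ell => (ell % 3 == (C.c0 : ℤ) % 3) && decide (0 ≤ ell + P.lamMin) &&
      bimp (ell + P.lamMin == 0) (P.contactBotOK C 0) && bimp (ell + P.lamMin == 1) (P.contactBotOK C 1)
  | Kind.top m => (((C.kr : ℤ) - m) % 3 == (C.c0 : ℤ) % 3) && decide (P.lamMax ≤ m) &&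
      bimp (P.lamMax == m) (P.contactTopOK C 0) && bimp (P.lamMax == m - 1) (P.contactTopOK C 1)
  | Kind.stk lam0 _ => decide (lam0 - 1 ≤ P.lamMin) && decide (P.lamMax ≤ lam0 + 4)

/-- The smallest `k` for which the plan's levels fit (used by the level lemmas): `free`: span + 2 (any `ℓ ≡ c0` with the core inside `[0,k]`
exists once `k ≥ λmax − λmin + 2`); `bot ℓ₀`: `ℓ₀ + λmax + 2`; `top m`: `m − λmin + 2`; `stk`: `9` (both terminals middle, three levels apart). [folklore] -/
def PlanD.kmin (P : PlanD) : ℤ :=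
  match P.kind with
  | Kind.free => P.lamMax - P.lamMin + 2
  | Kind.bot ell => ell + P.lamMax + 2
  | Kind.top m => m - P.lamMin + 2
  | Kind.stk _ _ => 9

/-- The terminal column of a terminal option. [folklore] -/
def TermD.col : TermD → Col
  | TermD.exact v => v.1
  | TermD.ride a _ => a.c

/-- The plan's terminal options sit on the configuration's columns. [folklore] -/
def PlanD.fits (P : PlanD) (c1 c2 c3 : Col) : Bool := (P.t1.col == c1) && (P.t2.col == c2) && (P.t3a.col == c3) && (P.t3b.col == c3)

/-- The largest `kmin` the certificate admits: the assembled theorem is stated for `k ≥ KMAX`. [folklore] -/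
def KMAX : ℤ := 10

/-- **THE CHECKER.** [folklore] -/
def PlanD.check (C : Ctx) (P : PlanD) : Bool :=
  P.structOK && P.validOK C && P.nodupOK && P.portOK && P.regionOK && P.termsOK C && P.envOK C && P.levelsOK C

/-! ## §3 Statuses served by a plan -/

/-- Statuses of a terminal level `h` in a film of thickness `k`: `0,1,2` (bottom), `9` (middle: `3 ≤ h ≤ k−3`), `10,11,12` (`h = k−2, k−1, k`). [folklore] -/
def statusOf (k : ℕ) (h : ℤ) : ℕ := if h ≤ 2 then h.toNat else if (k : ℤ) - 2 ≤ h then (12 - ((k : ℤ) - h)).toNat else 9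

/-- **Ride compatibility with a terminal status**: the extra step exists, and the face vertices the ride visits at the boundary levels next to the
terminal are cleared (peel codes). [folklore] -/
def rideStatusOK (C : Ctx) (a : AttD) (s : ℕ) : Bool :=
  if s ≤ 2 then
    let t : ℤ := s + a.ext      -- level reached on the face
    !(a.ext == -1 && s == 0) &&
      (if t ≤ 0 then codeFree C 0 (a.colBot C.c0 0) else true) && (if t ≤ 1 then codeFree C 1 (a.colBot C.c0 1) else true)
  else if 10 ≤ s then
    let j : ℤ := 12 - s - a.ext   -- face level reached is k − j
    !(a.ext == 1 && s == 12) &&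
      (if j ≤ 0 then codeFree C 3 (a.colTop C.c0 C.kr 0) else true) && (if j ≤ 1 then codeFree C 2 (a.colTop C.c0 C.kr 1) else true)
  else true

/-- The statuses a terminal option serves, given the kind (`roleIdx = 1, 2` for `E₁, E₂`, `3` for `w'`). [folklore] -/
def TermD.allows (C : Ctx) (kind : Kind) : TermD → ℕ → Bool
  | TermD.exact v, s => match kind with
      | Kind.bot ell => decide (s ≤ 2) && (ell + v.2 == s)
      | Kind.top m => decide (10 ≤ s) && decide (s ≤ 12) && (m - v.2 == 12 - s)
      | Kind.stk _ _ => s == 9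
      | Kind.free => false
  | TermD.ride a e, s => rideStatusOK C a s && (match e with
      | Env.any => true
      | Env.ge _ => decide (9 ≤ s) && decide (s ≤ 12)
      | Env.le _ => decide (s ≤ 9)) &&
      (match kind with | Kind.stk _ _ => (match e with | Env.ge _ => s == 9 | _ => true) | _ => true)

/-- **The status triples a plan serves.** [folklore] -/
def PlanD.allows (C : Ctx) (P : PlanD) (s1 s2 s3 : ℕ) : Bool :=
  P.t1.allows C P.kind s1 && P.t2.allows C P.kind s2 && P.t3a.allows C P.kind s3 && P.t3b.allows C P.kind s3

end Slab111

end Summit.CriticalPhenomena.PercolationContinuityZ3.Theorems.Transplant
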